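import Mathlib
import HarnessLib
import Literature.Analysis.FluidPDE.TypeIAncientMild
import Literature.Analysis.FluidPDE.KochTataruKernel
import Literature.Analysis.FluidPDE.ChaeWolfRemovingDSSBounds
import Summits.NavierStokesRegularity.NavierStokesRegularity.Theorems.PoloidalWindowDoorPoloidalWindowRigidityEternalCoreParaboloidGapTools
import Summits.NavierStokesRegularity.NavierStokesRegularity.Theorems.PoloidalWindowDoorPoloidalWindowRigidityEternalCoreParaboloidGapStep

/-!
# Route `PoloidalWindowDoor`, crux `PoloidalWindowRigidity` (stmt-NavierStokesRegularity-19708) — LINE 23 «eternal_core» v1.0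
# (ns-idea-8 g11, `Cruxes/PoloidalWindowRigidity/Lines/eternal_core.lean` 2a19051e6b6d; idea-crit-7 g7 PASS 07:38:50Z): support stub
# U2b `stub_paraboloidGap : ParaboloidGap`, VERBATIM (the Cruxes-local `ParaboloidGap` unfolded)

Seat ns-es-p1 g8 (free prover hand on ⟨19708⟩; CLAIM announced on the ideators bus before proposing).

* `paraboloidGap` — **THE PARABOLOID GAP (localised Kato / Koch–Tataru gap).**  For every Type-I constant `C` there is `ε₁ > 0`, and for
  every `0 < ε ≤ ε₁` an aperture `R₁ = R₁(C, ε)`, such that for every element `U` of the Type-I ancient mild class `A_C`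
  (`Literature.Analysis.FluidPDE.IsTypeIAncientMild C U`), scale-covariant `ε`-smallness on ONE parabolic window
  `{r ∈ [4t₀, t₀], ‖y‖ ≤ R√(−r)}` (`R ≥ R₁`) propagates FORWARD to `2ε`-smallness on the whole shrinking paraboloid
  `{s ∈ [t₀, 0), ‖x‖ ≤ (R/4)√(−s)}`.

PROOF.  Constants: Koch–Tataru's `K` (`exists_norm_oseenKernel_le`, (14) in parabolic form, d = 3), `M₀ = ∫(1+‖w‖²)^{−2}`,
`M₁ = ∫(1+‖w‖²)^{−7/4}`, `K₁ = KM₀`, `K₂ = KM₁`; `ε₁ := 1/(64K₁+1)`; given `ε`: `θ := min(1, ε²/(192K₁²C⁴+1))`, `Λ := 16K₂C²/ε + 1`,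
`R₁ := 128|C|/ε + 4Λ²/θ + 1`.  For `R ≥ R₁` the four scale-free smallness conditions of `…ParaboloidGapStep.step` hold (`128C ≤ εR`,
`64K₁ε ≤ 1`, `16K₂C²(θ²R²/16)^{−1/4} ≤ 16K₂C²/Λ ≤ ε` since `θ²R²/16 ≥ Λ⁴`, `192K₁²C⁴θ ≤ ε²`).  LADDER `aⱼ = t₀(1+θ)^{−2j} ↑ 0`: by induction
`√(−r)‖U(r,y)‖ ≤ 2ε` on `{r ∈ [4t₀, aⱼ], ‖y‖ ≤ (R/4)√(−r)}` (base: the window hypothesis, aperture `R ≥ R/4`; step: `…Step.step` at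
`s ∈ (aⱼ, aⱼ₊₁]`, where `4s ≤ aⱼ` and `(1+θ)²s ≤ aⱼ`); every `s ∈ [t₀, 0)` lies below some rung (`exists_pow_lt_of_lt_one`).

HONEST LABEL: ONE support stub (L) of a files-only PASSed line; it closes no cell, no crux and no route item; U2d, the research residue
`CellDefectiveReturnLeafCore`, ⟨19708⟩ / ⟨20428⟩ and NS regularity stay OPEN — no summit statement is proved here.
-/

noncomputable section

-- the summit and its single sub-problem share the name (CONVENTIONS §1), as in every Theorems file
set_option linter.dupNamespace false

namespace Summit.NavierStokesRegularity.NavierStokesRegularity.Theorems.PoloidalWindowDoorPoloidalWindowRigidityEternalCoreParaboloidGap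

open Set Function Filter MeasureTheory
open Literature.Analysis Literature.Analysis.FluidPDE Literature.Analysis.UnboundedOperators
open Summit.NavierStokesRegularity.NavierStokesRegularity.Theorems.PoloidalWindowDoorPoloidalWindowRigidityEternalCoreParaboloidGapTools
open Summit.NavierStokesRegularity.NavierStokesRegularity.Theorems.PoloidalWindowDoorPoloidalWindowRigidityEternalCoreParaboloidGapStep

/-! ## The stub -/

/-- **U2b `ParaboloidGap` (VERBATIM, the Cruxes-local def unfolded): the paraboloid gap** — scale-covariant `ε`-smallness (`ε ≤ ε₁(C)`) on
one parabolic window `{r ∈ [4t₀, t₀], ‖y‖ ≤ R√(−r)}`, `R ≥ R₁(C, ε)`, propagates forward to `2ε`-smallness on the shrinking paraboloid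
`{s ∈ [t₀, 0), ‖x‖ ≤ (R/4)√(−s)}` (module docstring for the proof). -/
theorem paraboloidGap :
    ∀ C : ℝ, ∃ ε₁ : ℝ, 0 < ε₁ ∧ ∀ ε : ℝ, 0 < ε → ε ≤ ε₁ → ∃ R₁ : ℝ, 0 < R₁ ∧ ∀ R : ℝ, R₁ ≤ R →
      ∀ (U : ℝ → EuclideanSpace ℝ (Fin 3) → EuclideanSpace ℝ (Fin 3)), IsTypeIAncientMild C U → ∀ t₀ : ℝ, t₀ < 0 →
        (∀ r ∈ Set.Icc (4 * t₀) t₀, ∀ y : EuclideanSpace ℝ (Fin 3), ‖y‖ ≤ R * Real.sqrt (-r) → Real.sqrt (-r) * ‖U r y‖ ≤ ε) →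
        ∀ s : ℝ, t₀ ≤ s → s < 0 → ∀ x : EuclideanSpace ℝ (Fin 3), ‖x‖ ≤ R / 4 * Real.sqrt (-s) →
          Real.sqrt (-s) * ‖U s x‖ ≤ 2 * ε := by
  intro C
  -- Koch–Tataru's kernel constant in dimension three and the two spatial moments
  obtain ⟨K, hK, hKb⟩ := exists_norm_oseenKernel_le (E := EuclideanSpace ℝ (Fin 3))
  set M₀ : ℝ := ∫ w : EuclideanSpace ℝ (Fin 3), (1 + ‖w‖ ^ 2) ^ (-(2 : ℝ)) with hM₀
  have hM₀0 : 0 ≤ M₀ := integral_nonneg fun w => Real.rpow_nonneg (by positivity) _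
  set M₁ : ℝ := ∫ w : EuclideanSpace ℝ (Fin 3), (1 + ‖w‖ ^ 2) ^ (-(7 / 4 : ℝ)) with hM₁
  have hM₁0 : 0 ≤ M₁ := integral_nonneg fun w => Real.rpow_nonneg (by positivity) _
  set K₁ : ℝ := K * M₀ with hK₁
  have hK₁0 : 0 ≤ K₁ := by positivity
  set K₂ : ℝ := K * M₁ with hK₂
  have hK₂0 : 0 ≤ K₂ := by positivity
  have finrank_R3_real : ((Module.finrank ℝ (EuclideanSpace ℝ (Fin 3)) : ℕ) : ℝ) = 3 := by simp
  have hK' : ∀ {τ : ℝ}, 0 < τ → ∀ z a b : EuclideanSpace ℝ (Fin 3),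
      ‖oseenKernel τ z a b‖ ≤ K * (τ + ‖z‖ ^ 2) ^ (-(2 : ℝ)) * ‖a‖ * ‖b‖ := by
    intro τ hτ z a b
    have h := hKb hτ z a b
    rw [finrank_R3_real, show (-(((3 : ℝ) + 1) / 2)) = -(2 : ℝ) by norm_num] at h
    exact h
  have hCW : ∀ {τ : ℝ}, 0 < τ → ∀ (x : EuclideanSpace ℝ (Fin 3))
      {f : EuclideanSpace ℝ (Fin 3) → EuclideanSpace ℝ (Fin 3)} {A : ℝ}, (∀ y, ‖f y‖ ≤ A) →
      ‖∫ y, oseenKernel τ (x - y) (f y) (f y)‖ ≤ K₁ * τ ^ (-(1 / 2 : ℝ)) * A ^ 2 := by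
    intro τ hτ x f A hA
    have h := ChaeWolf.norm_integral_oseenKernel_le hK' hK.le hτ x hA
    rw [← hM₀] at h
    calc ‖∫ y, oseenKernel τ (x - y) (f y) (f y)‖ ≤ K * M₀ * τ ^ (-(1 / 2 : ℝ)) * A ^ 2 := h
      _ = K₁ * τ ^ (-(1 / 2 : ℝ)) * A ^ 2 := by rw [hK₁]
  have hSP : ∀ {τ : ℝ}, 0 < τ → ∀ (x : EuclideanSpace ℝ (Fin 3))
      {f : EuclideanSpace ℝ (Fin 3) → EuclideanSpace ℝ (Fin 3)} {A B d : ℝ}, 0 < d → 0 ≤ A →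
      (∀ y, ‖x - y‖ ≤ d → ‖f y‖ ≤ A) → (∀ y, ‖f y‖ ≤ B) →
      ‖∫ y, oseenKernel τ (x - y) (f y) (f y)‖ ≤
        K₁ * τ ^ (-(1 / 2 : ℝ)) * A ^ 2 + K₂ * (d ^ 2) ^ (-(1 / 4 : ℝ)) * τ ^ (-(1 / 4 : ℝ)) * B ^ 2 := by
    intro τ hτ x f A B d hd hA0 hA hB
    have h := norm_integral_oseenKernel_le_split hK' hK.le hτ x hd hA0 hA hB
    rw [← hM₀, ← hM₁] at h
    calc ‖∫ y, oseenKernel τ (x - y) (f y) (f y)‖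
        ≤ K * M₀ * τ ^ (-(1 / 2 : ℝ)) * A ^ 2 + K * M₁ * (d ^ 2) ^ (-(1 / 4 : ℝ)) * τ ^ (-(1 / 4 : ℝ)) * B ^ 2 := h
      _ = K₁ * τ ^ (-(1 / 2 : ℝ)) * A ^ 2 + K₂ * (d ^ 2) ^ (-(1 / 4 : ℝ)) * τ ^ (-(1 / 4 : ℝ)) * B ^ 2 := by
          rw [hK₁, hK₂]
  -- `ε₁`
  set ε₁ : ℝ := 1 / (64 * K₁ + 1) with hε₁
  have hε₁0 : 0 < ε₁ := by positivity
  refine ⟨ε₁, hε₁0, ?_⟩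
  intro ε hε hεle
  have hc2 : 64 * K₁ * ε ≤ 1 := by
    have h1 : 64 * K₁ * ε ≤ 64 * K₁ * ε₁ := by gcongr
    have h2 : 64 * K₁ * ε₁ ≤ 1 := by
      rw [hε₁, mul_one_div, div_le_one (by positivity)]
      linarith
    exact h1.trans h2
  -- `θ = θ(C, ε)`
  set θ : ℝ := min 1 (ε ^ 2 / (192 * K₁ ^ 2 * C ^ 4 + 1)) with hθ
  have hθ0 : 0 < θ := lt_min one_pos (by positivity)
  have hθ1 : θ ≤ 1 := min_le_left _ _
  have hc4 : 192 * K₁ ^ 2 * C ^ 4 * θ ≤ ε ^ 2 := by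
    have h1 : θ ≤ ε ^ 2 / (192 * K₁ ^ 2 * C ^ 4 + 1) := min_le_right _ _
    have h2 : 192 * K₁ ^ 2 * C ^ 4 * θ ≤ (192 * K₁ ^ 2 * C ^ 4 + 1) * θ := by gcongr; linarith
    have h3 : (192 * K₁ ^ 2 * C ^ 4 + 1) * θ ≤ ε ^ 2 := by
      rw [← le_div_iff₀' (by positivity)]
      exact h1
    exact h2.trans h3
  -- `R₁ = R₁(C, ε, θ)`
  set Λ : ℝ := 16 * K₂ * C ^ 2 / ε + 1 with hΛ
  have hΛ0 : 0 < Λ := by positivity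
  set R₁ : ℝ := 128 * |C| / ε + 4 * Λ ^ 2 / θ + 1 with hR₁
  have hR₁0 : 0 < R₁ := by positivity
  refine ⟨R₁, hR₁0, ?_⟩
  intro R hR U hU t₀ ht₀ hwin s hts hs0 x hx
  have hRpos : 0 < R := lt_of_lt_of_le hR₁0 hR
  -- the two `R`-dependent smallness conditions
  have hc1 : 128 * C ≤ ε * R := by
    have h1 : 128 * |C| / ε ≤ R := by
      have : 0 ≤ 4 * Λ ^ 2 / θ := by positivity
      linarith
    have h2 : 128 * |C| ≤ ε * R := by
      rw [div_le_iff₀ hε] at h1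
      linarith
    have h3 : C ≤ |C| := le_abs_self C
    linarith only [h2, h3]
  have hc3 : 16 * K₂ * C ^ 2 * (θ ^ 2 * R ^ 2 / 16) ^ (-(1 / 4 : ℝ)) ≤ ε := by
    have h1 : 4 * Λ ^ 2 / θ ≤ R := by
      have : 0 ≤ 128 * |C| / ε := by positivity
      linarith
    have h2 : 4 * Λ ^ 2 ≤ θ * R := by
      rw [div_le_iff₀ hθ0] at h1
      linarith
    have h3 : Λ ^ 4 ≤ θ ^ 2 * R ^ 2 / 16 := by
      have h4 : (4 * Λ ^ 2) ^ 2 ≤ (θ * R) ^ 2 := pow_le_pow_left₀ (by positivity) h2 2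
      have e1 : (4 * Λ ^ 2) ^ 2 = 16 * Λ ^ 4 := by ring
      have e2 : (θ * R) ^ 2 = θ ^ 2 * R ^ 2 := by ring
      rw [e1, e2] at h4
      linarith only [h4]
    have hΛ4 : 0 < Λ ^ 4 := by positivity
    have h5 : (θ ^ 2 * R ^ 2 / 16) ^ (-(1 / 4 : ℝ)) ≤ (Λ ^ 4) ^ (-(1 / 4 : ℝ)) :=
      Real.rpow_le_rpow_of_nonpos hΛ4 h3 (by norm_num)
    have h6 : (Λ ^ 4) ^ (-(1 / 4 : ℝ)) = Λ⁻¹ := by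
      rw [show (Λ ^ 4 : ℝ) = Λ ^ ((4 : ℕ) : ℝ) by rw [Real.rpow_natCast], ← Real.rpow_mul hΛ0.le,
        show ((4 : ℕ) : ℝ) * (-(1 / 4 : ℝ)) = -1 by norm_num, Real.rpow_neg_one]
    rw [h6] at h5
    have h7 : 16 * K₂ * C ^ 2 * Λ⁻¹ ≤ ε := by
      rw [← div_eq_mul_inv, div_le_iff₀ hΛ0, hΛ]
      have e : ε * (16 * K₂ * C ^ 2 / ε + 1) = 16 * K₂ * C ^ 2 + ε := by field_simp
      rw [e]
      linarith
    calc 16 * K₂ * C ^ 2 * (θ ^ 2 * R ^ 2 / 16) ^ (-(1 / 4 : ℝ)) ≤ 16 * K₂ * C ^ 2 * Λ⁻¹ := by gcongr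
      _ ≤ ε := h7
  -- the ladder `a j = t₀ q^j`, `q = (1+θ)⁻²`
  have hκ0 : 0 < (1 + θ) ^ 2 := by positivity
  have hκe : (1 + θ) ^ 2 = 1 + (2 * θ + θ ^ 2) := by ring
  have hκ1 : 1 < (1 + θ) ^ 2 := by
    have : 0 < 2 * θ + θ ^ 2 := by positivity
    linarith only [hκe, this]
  have hκ4 : (1 + θ) ^ 2 ≤ 4 := by
    have : θ ^ 2 ≤ 1 := pow_le_one₀ hθ0.le hθ1
    linarith only [hκe, this, hθ1]
  set q : ℝ := ((1 + θ) ^ 2)⁻¹ with hq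
  have hq0 : 0 < q := inv_pos.2 hκ0
  have hq1 : q < 1 := inv_lt_one_of_one_lt₀ hκ1
  have hq4 : 1 ≤ 4 * q := by
    rw [hq, le_mul_inv_iff₀ hκ0]
    linarith
  have hκq : (1 + θ) ^ 2 * q = 1 := mul_inv_cancel₀ hκ0.ne'
  set a : ℕ → ℝ := fun j => t₀ * q ^ j with ha
  have ha_neg : ∀ j, a j < 0 := fun j => mul_neg_of_neg_of_pos ht₀ (pow_pos hq0 j)
  have ha_ge : ∀ j, t₀ ≤ a j := fun j => by
    have h1 : q ^ j ≤ 1 := pow_le_one₀ hq0.le hq1.le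
    have h2 : t₀ * 1 ≤ t₀ * q ^ j := mul_le_mul_of_nonpos_left h1 ht₀.le
    simp only [ha]
    linarith only [h2]
  have ha_succ : ∀ j, a (j + 1) = q * a j := fun j => by
    simp only [ha, pow_succ]; ring
  -- induction along the ladder
  have hclaim : ∀ j : ℕ, ∀ r : ℝ, 4 * t₀ ≤ r → r ≤ a j → ∀ y : EuclideanSpace ℝ (Fin 3),
      ‖y‖ ≤ R / 4 * Real.sqrt (-r) → Real.sqrt (-r) * ‖U r y‖ ≤ 2 * ε := by
    intro j
    induction j with
    | zero =>
      intro r hr1 hr2 y hy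
      have hr2' : r ≤ t₀ := by simpa [ha] using hr2
      have hy' : ‖y‖ ≤ R * Real.sqrt (-r) := by
        refine hy.trans (mul_le_mul_of_nonneg_right ?_ (Real.sqrt_nonneg (-r)))
        linarith only [hRpos]
      have h := hwin r ⟨hr1, hr2'⟩ y hy'
      linarith only [h, hε]
    | succ j ih =>
      intro r hr1 hr2 y hy
      rcases le_or_gt r (a j) with hra | hra
      · exact ih r hr1 hra y hy
      · -- `r ∈ (a j, q · a j]`: one forward step along the paraboloid
        rw [ha_succ] at hr2
        have haj := ha_neg j
        have hr0 : r < 0 := by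
          have := mul_neg_of_pos_of_neg hq0 haj
          linarith only [hr2, this]
        have h4r : 4 * r ≤ a j := by
          have h1 : 4 * r ≤ 4 * (q * a j) := by linarith only [hr2]
          have h2 : (4 * q) * a j ≤ 1 * a j := mul_le_mul_of_nonpos_right hq4 haj.le
          have h3 : 4 * (q * a j) = (4 * q) * a j := by ring
          linarith only [h1, h2, h3]
        have hθr : (1 + θ) ^ 2 * r ≤ a j := by
          have h1 : (1 + θ) ^ 2 * r ≤ (1 + θ) ^ 2 * (q * a j) := mul_le_mul_of_nonneg_left hr2 hκ0.le
          have h2 : (1 + θ) ^ 2 * (q * a j) = a j := by rw [← mul_assoc, hκq, one_mul]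
          linarith only [h1, h2]
        exact step hU hK₁0 hK₂0 hCW hSP hε hθ0 hθ1 hRpos hc1 hc2 hc3 hc4 ((ha_ge j).trans hra.le) hr0 h4r hθr ih y hy
  -- every `s ∈ [t₀, 0)` lies below some rung
  have hst : 0 < s / t₀ := div_pos_of_neg_of_neg hs0 ht₀
  obtain ⟨j, hj⟩ := exists_pow_lt_of_lt_one hst hq1
  have hsj : s ≤ a j := by
    have h1 : t₀ * (s / t₀) < t₀ * q ^ j := mul_lt_mul_of_neg_left hj ht₀
    have ht0 : t₀ ≠ 0 := ht₀.ne
    have h2 : t₀ * (s / t₀) = s := by field_simp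
    simp only [ha]
    linarith only [h1, h2]
  exact hclaim j s (by linarith only [hts, ht₀]) hsj x hx

end Summit.NavierStokesRegularity.NavierStokesRegularity.Theorems.PoloidalWindowDoorPoloidalWindowRigidityEternalCoreParaboloidGap

end
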